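import Mathlib.NumberTheory.NumberField.Basic
import Mathlib.FieldTheory.Galois.Basic
import Mathlib.RingTheory.AdjoinRoot
import Mathlib.Algebra.Polynomial.SpecificDegree
import HarnessLib

set_option linter.dupNamespace false -- `Summit.BirchSwinnertonDyer.BirchSwinnertonDyer.Theorems.…` (summit = sub)
set_option autoImplicit false

/-!
# Crux `EisensteinHeartFlatCMInertBadKPrime` (stmt-BirchSwinnertonDyer-21341), line `hsieh-lambda`, layer 2 —
# INSTANTIATION tranche 1d: EXISTENCE of the quadratic extension `L = K′(√d)` as a number field in `Type`

Companion of `…BiquadraticCMField.lean` / `…BiquadraticPrimes.lean` / `…BiquadraticCMType.lean` (same seat, same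
conventions: THEOREMS ONLY, helper toward stmt-BirchSwinnertonDyer-21341, nothing about the crux's input or BSD
asserted). Those files take the biquadratic field as abstract data `[Algebra K L]`, `finrank K L = 2`, `x ∈ L`,
`x² = d`; this file supplies such an `L` for every number field `K` and every integer `d` which is not a square in
`K` (`exists_quadratic_sqrt`: `L = K[X]/(X² − d)` via Mathlib's `AdjoinRoot`, a number field of relative degree `2`),
and records that a relative quadratic extension is Galois (`isGalois_of_finrank_eq_two`, the `[IsGalois K L]` of the V2
socket and of `ZpExtensionRestrict`). In the route `K = K′` (Heegner field), `d = d_CM`, and `d` is not a square in `K′`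
by `…BiquadraticPrimes.not_exists_sq_eq_of_split`.

References: [NeukirchANT1999] Ch. I §2; [Marcus2018] Ch. 2 (adjoining a square root).
-/

noncomputable section

open Polynomial Module

namespace Summit.BirchSwinnertonDyer.BirchSwinnertonDyer.Theorems.BiquadraticEisensteinDescentEisensteinHeartFlatCMInertBadKPrimeBiquadraticExists

/-- `X² − d` is irreducible over a field `K` (char `≠ 2` not needed) in which `d` is not a square. [folklore] -/
theorem irreducible_X_sq_sub_C {K : Type} [Field K] {d : K} (hd : ¬ ∃ y : K, y ^ 2 = d) :
    Irreducible (X ^ 2 - C d : K[X]) := by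
  have hmonic : (X ^ 2 - C d : K[X]).Monic := monic_X_pow_sub_C d two_ne_zero
  have hdeg : (X ^ 2 - C d : K[X]).natDegree = 2 := natDegree_X_pow_sub_C
  rw [hmonic.irreducible_iff_roots_eq_zero_of_degree_le_three (by omega) (by omega)]
  refine Multiset.eq_zero_of_forall_notMem fun y hy ↦ hd ⟨y, ?_⟩
  rw [mem_roots hmonic.ne_zero, IsRoot.def, eval_sub, eval_pow, eval_X, eval_C, sub_eq_zero] at hy
  exact hy

/-- **Existence of `L = K(√d)` in `Type`**: for a number field `K` and an integer `d` that is not a square in `K` there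
is a number field `L ⊇ K` with `[L : K] = 2` containing a square root of `d` (`L = K[X]/(X² − d)`). This realises the
abstract data `[Algebra K L]`, `finrank K L = 2`, `x² = d` of the biquadratic-field files (route: `K = K′`, `d = d_CM`).
[cite: NeukirchANT1999, Ch. I §2] -/
theorem exists_quadratic_sqrt (K : Type) [Field K] [NumberField K] (d : ℤ) (hd : ¬ ∃ y : K, y ^ 2 = (d : K)) :
    ∃ (L : Type) (_ : Field L) (_ : NumberField L) (_ : Algebra K L),
      finrank K L = 2 ∧ ∃ x : L, x ^ 2 = (d : L) := by
  set f : K[X] := X ^ 2 - C (d : K) with hf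
  have hirr : Irreducible f := irreducible_X_sq_sub_C hd
  haveI : Fact (Irreducible f) := ⟨hirr⟩
  have hf0 : f ≠ 0 := hirr.ne_zero
  have hdeg : f.natDegree = 2 := by rw [hf]; exact natDegree_X_pow_sub_C
  haveI hfin : Module.Finite K (AdjoinRoot f) := (AdjoinRoot.powerBasis hf0).finite
  haveI : CharZero (AdjoinRoot f) := charZero_of_injective_algebraMap (algebraMap K (AdjoinRoot f)).injective
  haveI : NumberField (AdjoinRoot f) :=
    { to_charZero := inferInstance
      to_finiteDimensional := Module.Finite.trans K (AdjoinRoot f) }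
  refine ⟨AdjoinRoot f, inferInstance, inferInstance, inferInstance, ?_, AdjoinRoot.root f, ?_⟩
  · rw [(AdjoinRoot.powerBasis hf0).finrank, AdjoinRoot.powerBasis_dim, hdeg]
  · have h := AdjoinRoot.eval₂_root f
    rw [hf, eval₂_sub, eval₂_pow, eval₂_X, eval₂_C, sub_eq_zero] at h
    rw [h, map_intCast]

/-- **A relative quadratic extension of number fields is Galois** (separable in characteristic `0`, normal as the
splitting field of the minimal polynomial of any non-trivial element; Mathlib `Algebra.IsQuadraticExtension.isGalois`).
The `[IsGalois K L]` hypothesis of `…KatzHsiehDisplay.exists_span_C_mul_eq` at `L = K′(√d_CM)`. [cite: NeukirchANT1999, Ch. IV §1] -/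
theorem isGalois_of_finrank_eq_two {K L : Type} [Field K] [NumberField K] [Field L] [NumberField L] [Algebra K L]
    (h2 : finrank K L = 2) : IsGalois K L := by
  haveI : Algebra.IsQuadraticExtension K L := { finrank_eq_two' := h2 }
  infer_instance

end Summit.BirchSwinnertonDyer.BirchSwinnertonDyer.Theorems.BiquadraticEisensteinDescentEisensteinHeartFlatCMInertBadKPrimeBiquadraticExists

end
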